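import Mathlib
import Summits.CriticalPhenomena.SAWScalingLimit.Theorems.NoFoldBound.Negative.BoundaryRayKernel
import Summits.CriticalPhenomena.SAWScalingLimit.Theorems.NoFoldBound.Negative.BoundaryRayPhasesB
import Literature.Barriers.CriticalPhenomena.ParafermionicHalfCauchyRiemann

/-!
# The boundary flux of the witness domain in coordinates, and the algebra of `ℚ(ζ₄₈)`

Crux `NoFoldBound` (stmt-CriticalPhenomena-8296), negative side, fifth support file of the
BOUNDARY-IDENTITY RAY. The Duminil-Copin–Smirnov identity of a source `b` in the domain `Ω` is the
vanishing of the BOUNDARY FLUX `hexFlux Ω F_b` (`HexGreen.hexFlux` of the barrier file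
`ParafermionicHalfCauchyRiemann.lean`: the sum over the boundary darts `(y, w)`, `y ∈ Ω ∌ w`, of
`(mid{y,w} - c_y) F_b({y,w})`). Here:

* `bdarts`, `hexFlux_rayOmega` — the flux of `Ω = rayOmega` as a sum over the explicit finset of its
  65 boundary darts in coordinates;
* `flux_eq_sum_support` — for `F = bphase(b, ·) · D(b, ·)` the flux reduces to the darts carrying
  the kernel (the vanishing elsewhere is decided on the table);
* `coef_eq` — the dart coefficient `mid{y,w} - c_y = (emb(pos w) - emb(pos y))/6`;
* `w24 = e^{iπ/24}` with `w24 ^ 24 = -1`, `omg = w24 ^ 8`, the phases `e^{-i(5/8)(π/3)c} = w24 ^ k`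
  (`phase_eq_pow`) and `2cos(π/8), 2cos(π/4), 2cos(3π/8)` as `w24³ + w24⁴⁵, w24⁶ + w24⁴², w24⁹ + w24³⁹`
  — so that every row identity becomes a polynomial identity modulo `w24²⁴ + 1`.

Sorry-free.
-/

noncomputable section

open Literature.Probability.LatticeModels Literature.Probability.RandomPlanarGeometry.SAW
open Literature.Barriers.CriticalPhenomena Literature.Barriers.CriticalPhenomena.HexKernel
  Literature.Barriers.CriticalPhenomena.HexGreen

open Summit.CriticalPhenomena.SAWScalingLimit.Theorems.MassRatio.Renewal.BridgeDictionary (ofHV_injective)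

namespace Summit.CriticalPhenomena.SAWScalingLimit.Theorems.NoFoldBound.Negative.BoundaryRay

/-! ### The flux in coordinates -/

/-- `Ω` is the image of its coordinate set. -/
theorem rayOmega_eq_map : rayOmega = omegaHV.map ⟨ofHV, ofHV_injective⟩ := by
  ext f
  rw [mem_rayOmega_iff, Finset.mem_map]
  constructor
  · intro h; exact ⟨toHV f, h, ofHV_toHV f⟩
  · rintro ⟨w, hw, rfl⟩; simpa using hw

/-- The outer neighbours of `ofHV y`, in coordinates. -/
theorem nbrs_filter_eq (y : HV) :
    (nbrs (ofHV y)).filter (fun w => w ∉ rayOmega) =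
      (((HV.nbrs y).filter fun w => w ∉ omegaHV).toFinset).map ⟨ofHV, ofHV_injective⟩ := by
  ext f
  rw [Finset.mem_filter, mem_nbrs_iff, Finset.mem_map, hexGraph_adj_iff_hvGraph_adj, toHV_ofHV,
    hvGraph_adj_iff_mem_nbrs, mem_rayOmega_iff]
  constructor
  · rintro ⟨h1, h2⟩
    exact ⟨toHV f, by simpa [List.mem_toFinset, List.mem_filter] using ⟨h1, h2⟩, ofHV_toHV f⟩
  · rintro ⟨w, hw, rfl⟩
    simpa [List.mem_toFinset, List.mem_filter] using hw

/-- **The boundary flux of `Ω` as a sum over its boundary darts in coordinates.** -/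
theorem hexFlux_rayOmega (F : Sym2 HexVertex → ℂ) :
    hexFlux rayOmega F = ∑ d ∈ bdarts, term F (ofHV d.1) (ofHV d.2) := by
  rw [hexFlux, rayOmega_eq_map, Finset.sum_map]
  simp only [Function.Embedding.coeFn_mk]
  rw [bdarts, Finset.sum_sigma]
  refine Finset.sum_congr rfl fun y _ => ?_
  rw [← rayOmega_eq_map, nbrs_filter_eq, Finset.sum_map]
  rfl

set_option maxRecDepth 8192 in
/-- **Reduction of a row to its support**: if the kernel row of the source `b = {ob, y}` vanishes on
every boundary dart outside `T ⊆ bdarts`, the flux of `bphase(b,·) · D(b,·)` is its sum over `T`. -/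
theorem flux_eq_sum_support (ob y : HV) (T : Finset (Σ _ : HV, HV)) (hT : T ⊆ bdarts)
    (hz : ∀ d ∈ bdarts, d ∉ T → coefQ (ekeyHV ob y) (ekeyHV d.1 d.2) = 0) :
    hexFlux rayOmega (fun m => bphase rayOmega s(ofHV ob, ofHV y) m * (rayD s(ofHV ob, ofHV y) m : ℂ)) =
      ∑ d ∈ T, term (fun m => bphase rayOmega s(ofHV ob, ofHV y) m * (rayD s(ofHV ob, ofHV y) m : ℂ))
        (ofHV d.1) (ofHV d.2) := by
  rw [hexFlux_rayOmega, ← Finset.sum_subset hT]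
  intro d hd hdT
  have hc := hz d hd hdT
  have h0 : rayD s(ofHV ob, ofHV y) s(ofHV d.1, ofHV d.2) = 0 := by
    rw [rayD, ekey_mk, ekey_mk, toHV_ofHV, toHV_ofHV, toHV_ofHV, toHV_ofHV]
    unfold ekeyHV at hc ⊢
    rw [hc]
    simp [evalT]
  rw [term, h0]
  simp

/-! ### The algebra: everything in powers of `w = e^{iπ/24}` -/

/-- Powers of `w` are exponentials. -/
theorem w24_pow (k : ℕ) : w24 ^ k = Complex.exp ((k : ℂ) * ((Real.pi / 24 : ℝ) * Complex.I)) := by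
  rw [w24, ← Complex.exp_nat_mul]

/-- `w²⁴ = -1`. -/
theorem w24_pow_24 : w24 ^ 24 = -1 := by
  rw [w24_pow, ← Complex.exp_pi_mul_I]
  congr 1; push_cast; ring

/-- `ω = e^{iπ/3} = w⁸`. -/
theorem omg_eq : HV.omg = w24 ^ 8 := by
  rw [HV.omg, w24_pow]; congr 1; push_cast; ring

/-- **The phase `e^{-i(5/8)(π/3)c}` is the power `wᵏ`, `k ≡ -5c (mod 48)`.** -/
theorem phase_eq_pow (c : ℤ) (k : ℕ) (n : ℤ) (h : (k : ℤ) = 48 * n - 5 * c) :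
    Complex.exp (-Complex.I * (5 / 8 : ℝ) * ((Real.pi / 3 * c : ℝ))) = w24 ^ k := by
  rw [w24_pow]
  have hk : (k : ℂ) = 48 * (n : ℂ) - 5 * (c : ℂ) := by exact_mod_cast h
  rw [hk]
  have e1 : (48 * (n : ℂ) - 5 * (c : ℂ)) * (((Real.pi / 24 : ℝ) : ℂ) * Complex.I) =
      (n : ℂ) * (2 * Real.pi * Complex.I) +
        (-Complex.I * ((5 / 8 : ℝ) : ℂ) * ((Real.pi / 3 * c : ℝ) : ℂ)) := by
    push_cast; ring
  rw [e1, Complex.exp_add, Complex.exp_int_mul_two_pi_mul_I, one_mul]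

/-- `2cos(mπ/8) = w^{3m} + w^{48-3m}`. -/
theorem two_cos_eq (m : ℕ) (hm : 3 * m ≤ 48) :
    ((2 * Real.cos (m * Real.pi / 8) : ℝ) : ℂ) = w24 ^ (3 * m) + w24 ^ (48 - 3 * m) := by
  push_cast
  rw [Complex.two_cos, w24_pow, w24_pow]
  congr 1
  · congr 1; push_cast; ring
  · rw [show ((48 - 3 * m : ℕ) : ℂ) = 48 - 3 * (m : ℂ) by
      rw [Nat.cast_sub hm]; push_cast; ring]
    rw [show (48 - 3 * (m : ℂ)) * (((Real.pi / 24 : ℝ) : ℂ) * Complex.I) =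
      (1 : ℤ) * (2 * Real.pi * Complex.I) + (-(m * Real.pi / 8 : ℂ)) * Complex.I by push_cast; ring,
      Complex.exp_add, Complex.exp_int_mul_two_pi_mul_I, one_mul]

/-- `t₁ = 2cos(π/8) = w³ + w⁴⁵`. -/
theorem tA_C : (tA : ℂ) = w24 ^ 3 + w24 ^ 45 := by
  have := two_cos_eq 1 (by norm_num); rw [tA]; simpa using this

/-- `t₂ = 2cos(π/4) = w⁶ + w⁴²`. -/
theorem tB_C : (tB : ℂ) = w24 ^ 6 + w24 ^ 42 := by
  have := two_cos_eq 2 (by norm_num)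
  rw [show ((2 : ℕ) : ℝ) * Real.pi / 8 = Real.pi / 4 by push_cast; ring] at this
  rw [tB]; simpa using this

/-- `t₃ = 2cos(3π/8) = w⁹ + w³⁹`. -/
theorem tC_C : (tC : ℂ) = w24 ^ 9 + w24 ^ 39 := by
  have := two_cos_eq 3 (by norm_num)
  rw [show ((3 : ℕ) : ℝ) * Real.pi / 8 = 3 * Real.pi / 8 by push_cast; ring] at this
  rw [tC]; simpa using this

/-- The value of a coefficient vector, in powers of `w`. -/
theorem evalT_C (n₀ n₁ n₂ n₃ : ℤ) :
    ((evalT (n₀, n₁, n₂, n₃) : ℝ) : ℂ) =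
      ((n₀ : ℂ) + (n₁ : ℂ) * (w24 ^ 3 + w24 ^ 45) + (n₂ : ℂ) * (w24 ^ 6 + w24 ^ 42) +
        (n₃ : ℂ) * (w24 ^ 9 + w24 ^ 39)) / 2 := by
  simp only [evalT]
  push_cast
  rw [tA_C, tB_C, tC_C]

/-- **The dart coefficient in coordinates**: `mid{y,w} - c_y = (emb(pos w) - emb(pos y))/6`. -/
theorem coef_eq (y w : HV) :
    hexMidpoint s(ofHV y, ofHV w) - hexCenter (ofHV y) =
      (HV.emb (HV.pos w) - HV.emb (HV.pos y)) / 6 := by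
  have ey := HV.emb_pos_toHV (ofHV y)
  have ew := HV.emb_pos_toHV (ofHV w)
  rw [toHV_ofHV] at ey ew
  rw [hexMidpoint_mk]
  linear_combination (-(1 : ℂ) / 6) * ew + ((1 : ℂ) / 6) * ey

/-- The dart coefficient from the coordinate difference `pos w - pos y = (p, q)`: `(p + q ω)/6 = (p + q w⁸)/6`. -/
theorem coef_eq_of_pos_sub (y w : HV) (p q : ℤ) (h : HV.pos w - HV.pos y = (p, q)) :
    hexMidpoint s(ofHV y, ofHV w) - hexCenter (ofHV y) = ((p : ℂ) + (q : ℂ) * w24 ^ 8) / 6 := by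
  rw [coef_eq, ← HV.emb_sub, h, ← omg_eq]
  simp [HV.emb]

/-- A term of a row: dart `(y', w')`, source `b`, once the phase and the kernel value are known. -/
theorem term_eq (b : Sym2 HexVertex) (y' w' : HV) {p q : ℤ} (h : HV.pos w' - HV.pos y' = (p, q))
    {φ : ℂ} (hφ : bphase rayOmega b s(ofHV y', ofHV w') = φ) {n₀ n₁ n₂ n₃ : ℤ}
    (hd : rayD b s(ofHV y', ofHV w') = evalT (n₀, n₁, n₂, n₃)) :
    term (fun m => bphase rayOmega b m * (rayD b m : ℂ)) (ofHV y') (ofHV w') =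
      ((p : ℂ) + (q : ℂ) * w24 ^ 8) / 6 *
        (φ * (((n₀ : ℂ) + (n₁ : ℂ) * (w24 ^ 3 + w24 ^ 45) + (n₂ : ℂ) * (w24 ^ 6 + w24 ^ 42) +
          (n₃ : ℂ) * (w24 ^ 9 + w24 ^ 39)) / 2)) := by
  rw [term, coef_eq_of_pos_sub y' w' p q h, hφ, hd, evalT_C]

end Summit.CriticalPhenomena.SAWScalingLimit.Theorems.NoFoldBound.Negative.BoundaryRay
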